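import Literature.Probability.RandomPlanarGeometry.HexSAWStripAmplitudeRatio
import Literature.Probability.RandomPlanarGeometry.HexSAWStripBetaCoefficientWidthTwo
import Literature.Probability.RandomPlanarGeometry.HexSAWStripBetaLengthWidthTwoLaw
import HarnessLib

/-!
# Width two: a critical irreducible bridge of `S₂` makes on average `(3 − √2)/4` surface contacts per step, and this ratio IS the
# slope of the transfer-matrix critical curve `det(I − M_x(y)) = 0` at `(x_c, y₂)` — Hellmann–Feynman in closed form
# (module «AMPLITUDE-RATIO-WIDTH-TWO»)

Topic `Literature/Probability/RandomPlanarGeometry` (continues «AMPLITUDE-RATIO» `HexSAWStripAmplitudeRatio.lean` — for every `T ≥ 2` and any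
positive right / left fixed vectors `u`, `ℓ` of the critical irreducible-bridge kernel `Iinf T y_T`:
`HV.lengthAmplitude_mul_meanSteps_eq` `Λℓ_T · ⟨ℓ, M̄_len u⟩ = 2Λ_T · y_T⟨ℓ, M̄_top u⟩` — with the two closed-form width-two amplitudes of the
tree, «BETA-COEFF-WIDTH-TWO» `HexSAWStripBetaCoefficientWidthTwo.lean` (`HV.tendsto_stripBcoeff_two_mul_pow`: `Λ₂ = (45 + √2)/28`; `HV.xc_sq_eq_half`,
`HV.kTwo`, `HV.wdet_xc_eq`: `W(x_c, y) = κ₂(y₂ − y)`) and «BETA-LENGTH-WIDTH-TWO-LAW» `HexSAWStripBetaLengthWidthTwoLaw.lean`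
(`HV.tendsto_betaLenSum_two_even`: `Λℓ₂ = (19 − 6√2)/8`), and the width-two transfer-matrix determinant `HV.W2.wdet x y = (1 − x²)(1 − x²y) − x⁶y`
of `HexSAWStripSurfaceWidthTwo.lean`).  Lane «pcv-sawmu» (CriticalPhenomena venture), a-p2 g23.  Sources of the SETTING: N. R. Beaton,
A. J. Guttmann, I. Jensen, J. Phys. A 45 (2012) 055208, §2 (the transfer matrix of the narrowest honeycomb strip — their width one is the lane's
`T = 2`); N. R. Beaton, M. Bousquet-Mélou, J. de Gier, H. Duminil-Copin, A. J. Guttmann, CMP 326 (2014), arXiv:1109.0358v5, §3.2 and Corollary 8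
(arXiv v5 p. 12: the strip at `(x_c, y_T)`); E. Seneta (1973) §6.2 Theorems 6.3–6.4; W. Feller I (1968) XIII.11.  Neither number below is printed
anywhere; in print one would differentiate the Perron eigenvalue of the `2 × 2` transfer matrix (Hellmann–Feynman), which is what §2 verifies
against the renewal route.

## What is proved (namespace `Literature.Probability.RandomPlanarGeometry.SAW.HV`; `y₂ = stripYT 2 = (10 + 8√2)/7`, `x_c² = (2 − √2)/2`,
## `M̄_top = (Σ_j j·m(j) y₂^{j−1})`, `M̄_len = (Σ_n n·M(n))` the first-moment matrices of the critical irreducible bridges of `S₂`, `W = W2.wdet`)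

* ★★★ `widthTwo_meanContacts_per_step` — `4 · y₂⟨ℓ, M̄_top u⟩ = (3 − √2) · ⟨ℓ, M̄_len u⟩`: under the invariant weighting
  `π(ω) ∝ ℓ_{start} x_c^{|ω|} y₂^{#top} u_{end}` a critical irreducible bridge of `S₂` has (mean top-level vertices)/(mean steps) `= (3 − √2)/4 = 0.39644…`
  (`Λℓ₂/(2Λ₂) = 7(19 − 6√2)/(4(45 + √2)) = (3 − √2)/4` in `ℚ(√2)`).
* ★★ `widthTwo_wdet_partials` — `∂_y W(x_c, ·)|_{y₂} = −κ₂`, `∂_x W(·, y₂)|_{x_c} = −2x_c(1 + y₂(1 − 2x_c² + 3x_c⁴))` (as `HasDerivAt`), and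
  `8 · ∂_y W = (17√2 − 23) · x_c ∂_x W`: the critical curve `{W = 0}` has logarithmic slope `−(y/x) dx/dy = y₂ ∂_yW/(x_c∂_xW) = (3 − √2)/4` at `(x_c, y₂)`.
* ★★★ `widthTwo_hellmannFeynman` — `⟨ℓ, M̄_top u⟩ · x_c ∂_x W(x_c, y₂) = ⟨ℓ, M̄_len u⟩ · ∂_y W(x_c, y₂)`: the renewal ratio of first moments
  (obtained for all `T` without any transfer matrix) equals at `T = 2` the ratio of the partial derivatives of the transfer-matrix determinant,
  as first-order perturbation of the Perron root predicts.  Two independent routes of the lane meet in one algebraic number.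

Label: LANE THEOREM (own result of lane «pcv-sawmu», a-p2 g23, 2026-08-27), closed-form corollary of «AMPLITUDE-RATIO» at `T = 2` plus an explicit
polynomial computation (the `ℚ(√2)` identities are certified by `linear_combination` with polynomial coefficients).  NOT claimed: any `T ≥ 3`
value, the identification `x₂(y) = ` the zero of `W(·, y)` as the growth-rate curve for `y ≠ y₂` (only the slope AT the critical point is compared),
a closed form of `⟨ℓ, M̄_top u⟩` or `⟨ℓ, M̄_len u⟩` separately.
-/

noncomputable section

open Finset Filter Topology Matrix Literature.Probability.LatticeModels Literature.Probability.Percolation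
  Literature.Analysis.Matrix

namespace Literature.Probability.RandomPlanarGeometry.SAW

namespace HV

open W2

/-- ★★★ **WIDTH TWO: MEAN CONTACTS PER STEP `= (3 − √2)/4`.**  For ANY positive right / left fixed vectors `u`, `ℓ` of the critical
irreducible-bridge kernel `Iinf 2 y₂` of the width-two honeycomb strip (`y₂ = (10 + 8√2)/7`):
`4 · y₂ ⟨ℓ, M̄_top u⟩ = (3 − √2) · ⟨ℓ, M̄_len u⟩`,
i.e. under the invariant weighting `π(ω) ∝ ℓ_{start} x_c^{|ω|} y₂^{#top(ω)} u_{end}` of the irreducible standard horizontal bridges of `S₂` the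
ratio (mean number of top-level vertices)/(mean number of steps) is EXACTLY `(3 − √2)/4 = 0.39644…` — from «AMPLITUDE-RATIO»
(`Λℓ·⟨ℓ, M̄_len u⟩ = 2Λ·y_T⟨ℓ, M̄_top u⟩`) and the two closed-form amplitudes of the tree, `Λ₂ = (45 + √2)/28` («BETA-COEFF-WIDTH-TWO») and
`Λℓ₂ = (19 − 6√2)/8` («BETA-LENGTH-WIDTH-TWO-LAW»): `Λℓ₂/(2Λ₂) = 7(19 − 6√2)/(4(45 + √2)) = (3 − √2)/4`.
[cite: BeatonBousquetMelouDeGierDuminilCopinGuttmann2014, §3.2 and Corollary 8 (arXiv v5 p. 12: the width-T strip at (x_c, y_T)); DuminilCopinHammond2013, §2.2 (irreducible bridges); Feller1968, XIII.11; lane «pcv-sawmu» a-p2 g23 — own result] -/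
theorem widthTwo_meanContacts_per_step {u ℓ : Fin (2 * 2) → ℝ} (hu0 : ∀ a, 0 < u a) (hℓ0 : ∀ b, 0 < ℓ b)
    (hu : Iinf 2 (stripYT 2) *ᵥ u = u) (hℓ : ℓ ᵥ* Iinf 2 (stripYT 2) = ℓ) :
    4 * (stripYT 2 * (ℓ ⬝ᵥ ((Matrix.of fun a b : Fin (2 * 2) => ∑' j : ℕ, (j : ℝ) * irCoeff 2 j a b * stripYT 2 ^ (j - 1)) *ᵥ u))) =
      (3 - Real.sqrt 2) *
        (ℓ ⬝ᵥ ((Matrix.of fun a b : Fin (2 * 2) => ∑' n : ℕ, (n : ℝ) * LMM 2 n (n : ℤ) (stripYT 2) a b) *ᵥ u)) := by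
  set dc := ℓ ⬝ᵥ ((Matrix.of fun a b : Fin (2 * 2) => ∑' j : ℕ, (j : ℝ) * irCoeff 2 j a b * stripYT 2 ^ (j - 1)) *ᵥ u) with hdc
  set dl := ℓ ⬝ᵥ ((Matrix.of fun a b : Fin (2 * 2) => ∑' n : ℕ, (n : ℝ) * LMM 2 n (n : ℤ) (stripYT 2) a b) *ᵥ u) with hdl
  have h := lengthAmplitude_mul_meanSteps_eq (T := 2) le_rfl hu0 hℓ0 hu hℓ tendsto_stripBcoeff_two_mul_pow tendsto_betaLenSum_two_even
  rw [← hdc, ← hdl] at h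
  have hr : Real.sqrt 2 ^ 2 = 2 := Real.sq_sqrt (by norm_num)
  -- over ℚ(√2): `(3 − √2)·16(45 + √2) = 112(19 − 6√2)`
  linear_combination (-56 * (45 - Real.sqrt 2) / 2023) * h + ((4 * (stripYT 2 * dc) + 42 * dl) / 2023) * hr

/-- ★★ **The partial derivatives of the width-two determinant at the critical point.**  For `W(x, y) = det(I − M_x(y)) =
(1 − x²)(1 − x²y) − x⁶y` (`W2.wdet`, the denominator of every width-two strip series):
`∂_y W(x_c, ·)|_{y₂} = −κ₂` (`κ₂ = W2.kTwo = x_c²(1 − x_c² + x_c⁴)`, the tree's `wdet_xc_eq`: `W(x_c, y) = κ₂(y₂ − y)` is affine in `y`) and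
`∂_x W(·, y₂)|_{x_c} = −2x_c(1 + y₂(1 − 2x_c² + 3x_c⁴))`; and these two numbers satisfy
`8 · ∂_y W = (17√2 − 23) · x_c ∂_x W`,
i.e. `∂_y W/(x_c ∂_x W) = (17√2 − 23)/8 = (3 − √2)/(4y₂) = 0.13020…` — the slope of the critical curve `W = 0` through `(x_c, y₂)`.
[cite: BeatonGuttmannJensen2012, §2 (the width-one (lane: width-two) transfer matrix and its determinant); BeatonBousquetMelouDeGierDuminilCopinGuttmann2014, Corollary 8 (arXiv v5 p. 12); lane «pcv-sawmu» a-p2 g23 — own computation] -/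
theorem widthTwo_wdet_partials :
    HasDerivAt (fun y => wdet hexCriticalFugacity y) (-kTwo) (stripYT 2) ∧
      HasDerivAt (fun x => wdet x (stripYT 2))
        (-(2 * hexCriticalFugacity * (1 + stripYT 2 * (1 - 2 * hexCriticalFugacity ^ 2 + 3 * hexCriticalFugacity ^ 4))))
        hexCriticalFugacity ∧
      8 * (-kTwo) = (17 * Real.sqrt 2 - 23) *
        (hexCriticalFugacity * -(2 * hexCriticalFugacity * (1 + stripYT 2 * (1 - 2 * hexCriticalFugacity ^ 2 + 3 * hexCriticalFugacity ^ 4)))) := by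
  refine ⟨?_, ?_, ?_⟩
  · have h : (fun y => wdet hexCriticalFugacity y) = fun y => kTwo * (yTwo - y) := funext wdet_xc_eq
    rw [h]
    have := ((hasDerivAt_id (stripYT 2)).const_sub yTwo).const_mul kTwo
    simpa using this
  · set y := stripYT 2
    have h : HasDerivAt (fun x : ℝ => (1 - x ^ 2) * (1 - x ^ 2 * y) - x ^ 6 * y)
        ((-(2 * hexCriticalFugacity ^ 1 * 1)) * (1 - hexCriticalFugacity ^ 2 * y) +
          (1 - hexCriticalFugacity ^ 2) * (-(2 * hexCriticalFugacity ^ 1 * 1 * y)) - 6 * hexCriticalFugacity ^ 5 * 1 * y)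
        hexCriticalFugacity := by
      have hx := hasDerivAt_id hexCriticalFugacity
      exact (((hx.pow 2).const_sub 1).mul (((hx.pow 2).mul_const y).const_sub 1)).sub ((hx.pow 6).mul_const y)
    have hfun : (fun x : ℝ => (1 - x ^ 2) * (1 - x ^ 2 * y) - x ^ 6 * y) = fun x => wdet x y := by
      funext x; unfold wdet; ring
    rw [hfun] at h
    convert h using 1
    ring
  · rw [stripYT_two]
    unfold kTwo
    have hX := xc_sq_eq_half
    have hr : Real.sqrt 2 ^ 2 = 2 := Real.sq_sqrt (by norm_num)
    linear_combination ((-1298/7) + (1130/7) * Real.sqrt 2 + (241/7) * Real.sqrt 2 ^ 2 + (-565/7) * Real.sqrt 2 ^ 3 +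
        (204/7) * Real.sqrt 2 ^ 4 + (-460/7) * hexCriticalFugacity ^ 2 + (690/7) * hexCriticalFugacity ^ 2 * Real.sqrt 2 +
        (314/7) * hexCriticalFugacity ^ 2 * Real.sqrt 2 ^ 2 + (-408/7) * hexCriticalFugacity ^ 2 * Real.sqrt 2 ^ 3 +
        (-1436/7) * hexCriticalFugacity ^ 4 + (-12) * hexCriticalFugacity ^ 4 * Real.sqrt 2 +
        (816/7) * hexCriticalFugacity ^ 4 * Real.sqrt 2 ^ 2) * hX +
      ((649/7) + (-1779/14) * Real.sqrt 2 + (139/2) * Real.sqrt 2 ^ 2 + (-102/7) * Real.sqrt 2 ^ 3) * hr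

/-- ★★★ **HELLMANN–FEYNMAN AT WIDTH TWO, IN CLOSED FORM.**  For ANY positive right / left fixed vectors `u`, `ℓ` of the critical kernel
`Iinf 2 y₂`:
`⟨ℓ, M̄_top u⟩ · (x_c ∂_x W(x_c, y₂)) = ⟨ℓ, M̄_len u⟩ · ∂_y W(x_c, y₂)`
with `W = W2.wdet` the transfer-matrix determinant and the two partial derivatives of `widthTwo_wdet_partials`: the renewal-theoretic ratio
(mean contacts)/(mean steps, counted as `x ∂_x`) of a critical irreducible bridge — obtained in the tree WITHOUT any transfer matrix, by
renewal theory along the column — coincides at `T = 2` with the ratio of the partial derivatives of the transfer-matrix determinant at the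
critical point, i.e. with the slope of the critical curve `{W = 0}`, as first-order perturbation theory of the Perron eigenvalue predicts
(`∂λ = ℓ(∂M)u/ℓu`).  Two independent routes of the lane (transfer matrix for `T = 2`; renewal theory for all `T`) meet in one number.
[cite: BeatonGuttmannJensen2012, §2 (transfer matrix of the narrow strip); Seneta1973, §6.2 Theorems 6.3–6.4; Feller1968, XIII.11; DuminilCopinHammond2013, §2.2; BeatonBousquetMelouDeGierDuminilCopinGuttmann2014, Corollary 8; lane «pcv-sawmu» a-p2 g23 — own result] -/
theorem widthTwo_hellmannFeynman {u ℓ : Fin (2 * 2) → ℝ} (hu0 : ∀ a, 0 < u a) (hℓ0 : ∀ b, 0 < ℓ b)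
    (hu : Iinf 2 (stripYT 2) *ᵥ u = u) (hℓ : ℓ ᵥ* Iinf 2 (stripYT 2) = ℓ) :
    (ℓ ⬝ᵥ ((Matrix.of fun a b : Fin (2 * 2) => ∑' j : ℕ, (j : ℝ) * irCoeff 2 j a b * stripYT 2 ^ (j - 1)) *ᵥ u)) *
        (hexCriticalFugacity *
          -(2 * hexCriticalFugacity * (1 + stripYT 2 * (1 - 2 * hexCriticalFugacity ^ 2 + 3 * hexCriticalFugacity ^ 4)))) =
      (ℓ ⬝ᵥ ((Matrix.of fun a b : Fin (2 * 2) => ∑' n : ℕ, (n : ℝ) * LMM 2 n (n : ℤ) (stripYT 2) a b) *ᵥ u)) * (-kTwo) := by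
  set dc := ℓ ⬝ᵥ ((Matrix.of fun a b : Fin (2 * 2) => ∑' j : ℕ, (j : ℝ) * irCoeff 2 j a b * stripYT 2 ^ (j - 1)) *ᵥ u) with hdc
  set dl := ℓ ⬝ᵥ ((Matrix.of fun a b : Fin (2 * 2) => ∑' n : ℕ, (n : ℝ) * LMM 2 n (n : ℤ) (stripYT 2) a b) *ᵥ u) with hdl
  have h1 := widthTwo_meanContacts_per_step hu0 hℓ0 hu hℓ
  rw [← hdc, ← hdl] at h1
  -- the algebraic heart: `(3 − √2) · x_c ∂_x W = −4 y₂ κ₂`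
  have key : (3 - Real.sqrt 2) * (hexCriticalFugacity *
      -(2 * hexCriticalFugacity * (1 + stripYT 2 * (1 - 2 * hexCriticalFugacity ^ 2 + 3 * hexCriticalFugacity ^ 4)))) =
      -4 * (stripYT 2 * kTwo) := by
    rw [stripYT_two]
    unfold kTwo
    have hX := xc_sq_eq_half
    have hr : Real.sqrt 2 ^ 2 = 2 := Real.sq_sqrt (by norm_num)
    linear_combination ((-122/7) + (90/7) * Real.sqrt 2 + (37/7) * Real.sqrt 2 ^ 2 + (-45/7) * Real.sqrt 2 ^ 3 +
        (12/7) * Real.sqrt 2 ^ 4 + (-60/7) * hexCriticalFugacity ^ 2 + (6) * hexCriticalFugacity ^ 2 * Real.sqrt 2 +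
        (6) * hexCriticalFugacity ^ 2 * Real.sqrt 2 ^ 2 + (-24/7) * hexCriticalFugacity ^ 2 * Real.sqrt 2 ^ 3 +
        (-20) * hexCriticalFugacity ^ 4 + (-52/7) * hexCriticalFugacity ^ 4 * Real.sqrt 2 +
        (48/7) * hexCriticalFugacity ^ 4 * Real.sqrt 2 ^ 2) * hX +
      ((61/7) + (-151/14) * Real.sqrt 2 + (69/14) * Real.sqrt 2 ^ 2 + (-6/7) * Real.sqrt 2 ^ 3) * hr
  have hy0 : (0 : ℝ) < stripYT 2 := stripYT_pos (by norm_num)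
  -- `dc = (3 − √2) dl/(4 y₂)`; multiply `key` by `dl/(4 y₂)`
  have h2 : dc * (4 * stripYT 2) = (3 - Real.sqrt 2) * dl := by linarith [h1]
  have h5 : (4 * stripYT 2) * (dc * (hexCriticalFugacity *
      -(2 * hexCriticalFugacity * (1 + stripYT 2 * (1 - 2 * hexCriticalFugacity ^ 2 + 3 * hexCriticalFugacity ^ 4))))) =
      (4 * stripYT 2) * (dl * (-kTwo)) := by
    linear_combination (hexCriticalFugacity *
      -(2 * hexCriticalFugacity * (1 + stripYT 2 * (1 - 2 * hexCriticalFugacity ^ 2 + 3 * hexCriticalFugacity ^ 4)))) * h2 +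
      dl * key
  exact mul_left_cancel₀ (by positivity) h5

end HV

end Literature.Probability.RandomPlanarGeometry.SAW
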